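import Summits.ResolutionOfSingularities.ResolutionOfSingularities.Theorems.FrobeniusClosingSteerArithReturnIdCone
import Summits.ResolutionOfSingularities.ResolutionOfSingularities.Theorems.FrobeniusClosingSteerArithReturnId
import HarnessLib

/-!
# Crux `Steer` (stmt-ResolutionOfSingularities-16345), β-leaf debt K-β0(a) — lemma (S) SAT-PARITY: the EVEN parity bound and its τ-parity reading
  (res-D-pv-053 g9; res-L0-w41-plan-1 RULING 317 (c); reader res-L0-w41-tri-1 g8; memo `D/res-D-pv-053/K-BETA0A-SCOPE.md` §4)

OURS (campaign `res-hironaka`, rung L ★L-G4, slot W4.1). Candidates' vocabulary made kernel; nothing here is a statement of H. Hironaka's manuscript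
[Hironaka2017] (status: under review). AI-written; AI review is weaker than expert review. Def-free, Theses-free, 0 sorries.

## What is proved

tri-1 §169d (i): after a FREE step `A → B₁` (the A-cone `F` is `U`-free in adapted coordinates, `B₁` the `u`-chart origin, `f_{B₁} = □ + u·F(t) + u²θ`),
a B-landing `j″` of the NEXT visit which is a SATELLITE with respect to `u` (`u/u′ ∈ 𝔪″`) forces `F` to be BINARY. Two halves:

* `SatParity.evenParityBound` (run currency, E-FREE) — the EVEN twin of `NearA.parityBound` / `ReturnId.returnIdentity`: at a visit pair `(j, j′)` with
  exceptional `u`, cleaned order `d + 1` at BOTH ends (`d` odd `≥ 3`; B → B typing, free or satellite alike), for every cleaner `g` at `j` the weak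
  transform `f₁` of `f_j − g²` (`= u^(d+1)·f₁`) satisfies `f₁ = W²·(f_{j′} − h²) + V²` for every `h ∈ R j′`: modulo `𝔪′^(d+1)` it is a SQUARE.
* `SatParity.isHomogeneous_translate_of_X_mul_congr_sq` (polynomial reading) — in `k[T_σ]` of characteristic two with a distinguished variable `τ = T_i`:
  if `P` is `τ`-free of total degree `≤ d`, `eval a` kills `𝔮` with `a_i = 0` (the landing point lies on `τ = 0`: the SATELLITE condition), and
  `c·τ·(P + τ·Q) − V² ∈ 𝔮^(d+1)` with `c ≠ 0`, then `P(T + a)` is a FORM of degree `d` — every monomial of a square has EVEN `τ`-exponent, so the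
  `τ¹`-slice of the congruence kills all components of `P(T + a)` of degree `< d`. Read with `P = F(1, T₂, T₃)`: `F = Ξ(T₂ − a₂T₁, T₃ − a₃T₁)` is binary
  (p531760's (R2)/(R4) with the square ambiguity of the even degree `d + 1` removed by `τ`-parity).

[cite: CossartJannsenSaito2020, §2.2 (p. 24)] [folklore]
-/

noncomputable section

-- `Summit.<S>.<S>.…` duplicates the summit name by design (single-problem summit).
set_option linter.dupNamespace false

open IsLocalRing MvPolynomial
open Literature.AlgebraicGeometry.Resolution
open Summit.ResolutionOfSingularities.ResolutionOfSingularities.Theorems.SwitchingDichotomy.Words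

namespace Summit.ResolutionOfSingularities.ResolutionOfSingularities.Theorems.SwitchingDichotomy.ArithTransport

namespace SatParity

/-! ## §1 The even parity bound at a B → B visit (run currency) -/

section Run

variable {K : Type} [Field K] [CharP K 2] {O : ValuationSubring K} {R : ℕ → Subring K} {P : (i : ℕ) → Ideal (R i)}
  {t : K} {s : ℕ → K}

/-- **(S1) the EVEN parity bound.** Visit pair `(j, j′)`, exceptional `u` with strips and N4's height-one clause at `j′`, cleaned order `d + 1` at `j`
and at `j′` (`d` odd `≥ 3`). Then `R j′ = R (j+1)`, `u` is a regular parameter and a prime of `R j′`, and for every cleaner `g` at `j`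
(`f_j − g² ∈ 𝔪_j^(d+1)`) the weak transform `f₁` (`f_j − g² = u^(d+1)·f₁`) is a square modulo `W²·(f_{j′} − h²)` for EVERY `h`:
`f₁ = W²·(f_{j′} − h²) + V²`. E-free. [folklore] -/
theorem evenParityBound (hrun : IsSteeredRun O R P t 2 s) (hR0 : SubringDominates (R 0) O.toSubring)
    (hreg : ∀ i, IsRegularLocalRing (R i)) {j j' : ℕ} (hvisit : IsVisitPair R P j j') {u : K}
    (hu : (∃ h : u ∈ R j, (⟨u, h⟩ : R j) ∈ P j) ∧ u ≠ 0 ∧ ∀ y : R j, y ∈ P j → O.valuation (y : K) ≤ O.valuation u)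
    (Hγ : ∀ l, j < l → l < j' → ∃ hu : u ∈ R l, P l = Ideal.span {(⟨u, hu⟩ : R l)})
    (h1 : ∀ (hs' : s j' ^ 2 ∈ R j') (Q : Ideal (R j')) [Q.IsPrime], Q.height = 1 →
      ¬ SigmaTopLegality.IsSingPrime (R j') 2 ⟨s j' ^ 2, hs'⟩ Q)
    {d : ℕ} (hd : Odd d) (h3 : 3 ≤ d) (hclj : HasCleanedOrderAt R s 2 j (d + 1)) :
    ∃ (_ : IsLocalRing (R j)) (_ : IsLocalRing (R j')) (_ : R j' = R (j + 1)) (hu' : u ∈ R j') (hsj : s j ^ 2 ∈ R j)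
      (hsj' : s j' ^ 2 ∈ R j'),
      (⟨u, hu'⟩ : R j') ∈ maximalIdeal (R j') ∧ (⟨u, hu'⟩ : R j') ∉ maximalIdeal (R j') ^ 2 ∧ Prime (⟨u, hu'⟩ : R j') ∧
      ∀ g : R j, (⟨s j ^ 2, hsj⟩ : R j) - g ^ 2 ∈ maximalIdeal (R j) ^ (d + 1) →
        ∃ (f₁ W : R j'), IsUnit W ∧ ((((⟨s j ^ 2, hsj⟩ : R j) - g ^ 2 : R j) : K)) = u ^ (d + 1) * (f₁ : K) ∧
          ∀ h : R j', ∃ V : R j', f₁ = W ^ 2 * ((⟨s j' ^ 2, hsj'⟩ : R j') - h ^ 2) + V ^ 2 := by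
  classical
  haveI hRloc : ∀ i, IsLocalRing (R i) := fun i => (hrun.2 i).1
  have hdom : ∀ i, SubringDominates (R i) O.toSubring := fun i => VisitLawPointStep.subringDominates_of_run hrun hR0 i
  have hbl : ∀ i, IsLocalBlowupAlong O (R i) (P i) (R (i + 1)) := fun i => (hrun.2 i).2.2.2.1
  have h2K : (2 : K) = 0 := CharTwo.two_eq_zero
  obtain ⟨_, hPj⟩ := hvisit.2.1
  have hutrip := hu
  obtain ⟨⟨huR, huP⟩, hu0, humax⟩ := hu
  have hum : (⟨u, huR⟩ : R j) ∈ maximalIdeal (R j) := by rw [← hPj]; exact huP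
  have humax' : ∀ y : R j, y ∈ maximalIdeal (R j) → O.valuation (y : K) ≤ O.valuation u :=
    fun y hy => humax y (by rw [hPj]; exact hy)
  have hbl𝔪 : IsLocalBlowupAlong O (R j) (maximalIdeal (R j)) (R (j + 1)) := by rw [← hPj]; exact hbl j
  haveI hregj : IsRegularLocalRing (R j) := hreg j
  haveI hreg1 : IsRegularLocalRing (R (j + 1)) := hreg (j + 1)
  have hle : R j ≤ R (j + 1) := (hbl j).isLocalBlowup.le
  have hu1 : u ∈ R (j + 1) := hle huR
  obtain ⟨hum1, hu21, hprime1⟩ := VisitLawPointStep.prime_excParam_succ hrun hR0 hvisit.2.1 (hreg j) (hreg (j + 1)) hutrip hu1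
  obtain ⟨⟨hRj', G, W, hG, hW, hWinv, hW0, hlaw⟩, -, -⟩ :=
    VisitLawDelta.visitLaw₂_of_run hrun hR0 hvisit hutrip Hγ hreg h1 (by omega : 2 ≤ d + 1) hclj
  have hsj : s j ^ 2 ∈ R j := VisitLawPointStep.pow_mem_of_run hrun j
  have hsj' : s j' ^ 2 ∈ R j' := VisitLawPointStep.pow_mem_of_run hrun j'
  have key : ∀ (S : Subring K) (hS : S = R (j + 1)) [IsLocalRing S] (huS : u ∈ S),
      (⟨u, huS⟩ : S) ∈ maximalIdeal S ∧ (⟨u, huS⟩ : S) ∉ maximalIdeal S ^ 2 ∧ Prime (⟨u, huS⟩ : S) := by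
    intro S hS _ huS
    subst hS
    exact ⟨hum1, hu21, hprime1⟩
  have hu' : u ∈ R j' := by rw [hRj']; exact hu1
  obtain ⟨hum', hu2', hprime'⟩ := key (R j') hRj' hu'
  haveI hregj' : IsRegularLocalRing (R j') := hreg j'
  haveI := isDomain_of_isRegularLocalRing (R j')
  haveI := isIntegrallyClosed_of_isRegularLocalRing (R j')
  have hu0' : (⟨u, hu'⟩ : R j') ≠ 0 := fun h0 => hu0 (congrArg Subtype.val h0)
  have hWunit : IsUnit (⟨W, hW⟩ : R j') :=
    isUnit_iff_exists_inv.mpr ⟨⟨W⁻¹, hWinv⟩, Subtype.ext (by push_cast; exact mul_inv_cancel₀ hW0)⟩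
  refine ⟨hRloc j, hRloc j', hRj', hu', hsj, hsj', hum', hu2', hprime', fun g hg => ?_⟩
  -- the weak transform of `F := f_j − g²` (order exactly `d + 1`)
  obtain ⟨_, hsj0, -, hmaxj⟩ := hclj
  have hsjeq : (⟨s j ^ 2, hsj0⟩ : R j) = ⟨s j ^ 2, hsj⟩ := Subtype.ext rfl
  have hgnot : (⟨s j ^ 2, hsj⟩ : R j) - g ^ 2 ∉ maximalIdeal (R j) ^ (d + 1 + 1) := by rw [← hsjeq]; exact hmaxj g
  obtain ⟨w, hw, -⟩ := PointStepOrderBound.div_pow_not_mem_pow_succ_of_pointStep (hdom j) hbl𝔪 huR hum hu0 humax' hg hgnot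
  have hwj' : (w : K) ∈ R j' := by rw [hRj']; exact w.2
  have hgK : ((g : R j) : K) ∈ R j' := by rw [hRj']; exact hle g.2
  obtain ⟨e, rfl⟩ := hd
  have he : (2 * e + 1 + 1) / 2 = e + 1 := by omega
  rw [he] at hlaw
  have hwK : s j ^ 2 - ((g : R j) : K) ^ 2 = u ^ (2 * e + 1 + 1) * (w : K) := by
    have := hw
    push_cast at this
    rw [← this]; ring
  have hK : u ^ (2 * (e + 1)) * (W ^ 2 * s j' ^ 2 - (w : K)) = (G + ((g : R j) : K)) ^ 2 := by
    have hsq : (s j' * u ^ (e + 1) * W) ^ 2 = (s j - G) ^ 2 := by rw [hlaw]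
    linear_combination hsq + hwK - (s j * G + G * ((g : R j) : K)) * h2K
  have hRj : (⟨u, hu'⟩ : R j') ^ (2 * (e + 1)) * (⟨W, hW⟩ ^ 2 * ⟨s j' ^ 2, hsj'⟩ - ⟨(w : K), hwj'⟩) =
      ((⟨G, hG⟩ : R j') + ⟨((g : R j) : K), hgK⟩) ^ 2 := by
    apply Subtype.ext
    push_cast
    exact hK
  obtain ⟨S, hS⟩ := sq_of_pow_mul_eq_sq hu0' (e + 1) hRj
  have h2 : (2 : R j') = 0 := by exact_mod_cast CharP.cast_eq_zero (R j') 2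
  refine ⟨⟨(w : K), hwj'⟩, ⟨W, hW⟩, hWunit, ?_, fun h => ⟨⟨W, hW⟩ * h + S, ?_⟩⟩
  · push_cast; exact hwK
  · have key2 : (⟨(w : K), hwj'⟩ : R j') = ⟨W, hW⟩ ^ 2 * (⟨s j' ^ 2, hsj'⟩ - h ^ 2) + (⟨W, hW⟩ * h + S) ^ 2
        - 2 * (⟨W, hW⟩ * h * S + S ^ 2) - ((⟨W, hW⟩ ^ 2 * ⟨s j' ^ 2, hsj'⟩ - ⟨(w : K), hwj'⟩) - S ^ 2) := by ring
    rw [key2, h2, zero_mul, sub_zero, hS, sub_self, sub_zero]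

end Run

/-! ## §2 The τ-parity reading: the `τ¹`-slice of a square is zero -/

section Reading

variable {k : Type*} [Field k] [CharP k 2] {σ : Type*}

/-- In characteristic two every monomial of a square has an EVEN exponent at each variable. [folklore] -/
theorem coeff_sq_eq_zero_of_odd (V : MvPolynomial σ k) {m : σ →₀ ℕ} {i : σ} (hm : Odd (m i)) : coeff m (V ^ 2) = 0 := by
  classical
  rw [ReturnId.sq_eq_sum_monomial_two_nsmul, coeff_sum]
  refine Finset.sum_eq_zero fun m' _ => ?_
  rw [coeff_monomial, if_neg]
  intro h
  have : m i = 2 * m' i := by rw [← h]; simp [two_mul]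
  obtain ⟨r, hr⟩ := hm
  omega

omit [CharP k 2] in
/-- Translating by a point with `a_i = 0` keeps a `τ`-free polynomial `τ`-free (`τ = T_i`). [folklore] -/
theorem not_mem_vars_translate [DecidableEq σ] {P : MvPolynomial σ k} {i : σ} (hP : i ∉ P.vars) (a : σ → k) :
    i ∉ (bind₁ (fun j => X j + C (a j)) P).vars := by
  classical
  intro hi
  have h := vars_bind₁ (fun j => X j + C (a j)) P hi
  rw [Finset.mem_biUnion] at h
  obtain ⟨j, hj, hij⟩ := h
  have hsub : (X j + C (a j) : MvPolynomial σ k).vars ⊆ {j} := by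
    refine (vars_add_subset _ _).trans ?_
    rw [vars_X, vars_C, Finset.union_empty]
  have := Finset.mem_singleton.mp (hsub hij)
  subst this
  exact hP hj

/-- **(S2) the τ-parity reading.** `k` of characteristic two, `i` a distinguished variable (`τ = T_i`), `P` a `τ`-FREE polynomial of total degree
`≤ d`, `Q`, `V` arbitrary, `c ≠ 0`; `eval a` kills the ideal `𝔮` and `a i = 0` (the point lies on `τ = 0`). If `c·τ·(P + τ·Q) − V² ∈ 𝔮^(d+1)` then
`P(T + a)` is a FORM of degree `d`: the `τ¹`-slice of the congruence — squares have only EVEN `τ`-exponents — kills every monomial of `P(T + a)` of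
degree `< d`. [cite: CossartJannsenSaito2020, §2.2 (p. 24)] -/
theorem isHomogeneous_translate_of_X_mul_congr_sq [DecidableEq σ] (𝔮 : Ideal (MvPolynomial σ k)) (a : σ → k)
    (hrat : ∀ f ∈ 𝔮, eval a f = 0) (i : σ) (hai : a i = 0)
    {d : ℕ} {P Q V : MvPolynomial σ k} (hP : i ∉ P.vars) (hdeg : P.totalDegree ≤ d) {c : k} (hc : c ≠ 0)
    (h : C c * X i * (P + X i * Q) - V ^ 2 ∈ 𝔮 ^ (d + 1)) :
    (bind₁ (fun j => X j + C (a j)) P).IsHomogeneous d := by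
  classical
  -- translate: `χ = (T ↦ T + a)` fixes `τ` and carries `𝔮` into `(T)`
  let χ : MvPolynomial σ k →+* MvPolynomial σ k :=
    (bind₁ (fun j => X j + C (a j)) : MvPolynomial σ k →ₐ[k] MvPolynomial σ k).toRingHom
  have hχ : Ideal.map χ 𝔮 ≤ idealOfVars σ k := by
    rw [Ideal.map_le_iff_le_comap]
    intro f hf
    rw [Ideal.mem_comap]
    have h1 : idealOfVars σ k = idealOfVars σ k ^ 1 := (pow_one _).symm
    rw [h1, mem_pow_idealOfVars_iff']
    intro x hx
    have hx0 : x = 0 := by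
      by_contra hne
      have : 1 ≤ x.degree := Nat.one_le_iff_ne_zero.mpr ((Finsupp.degree_eq_zero_iff x).not.mpr hne)
      omega
    subst hx0
    change coeff 0 (bind₁ (fun j => X j + C (a j)) f) = 0
    rw [← constantCoeff_eq, ← eval_zero, NonRationalWindow.BiConeForms.eval_bind₁_translate, zero_add, hrat f hf]
  have hmem := Ideal.pow_right_mono hχ (d + 1) (by rw [← Ideal.map_pow]; exact Ideal.mem_map_of_mem χ h)
  have hχτ : bind₁ (fun j => X j + C (a j)) (X i : MvPolynomial σ k) = X i := by rw [bind₁_X_right, hai, C_0, add_zero]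
  set P' := bind₁ (fun j => X j + C (a j)) P with hP'
  set Q' := bind₁ (fun j => X j + C (a j)) Q with hQ'
  set V' := bind₁ (fun j => X j + C (a j)) V with hV'
  have hχeq : χ (C c * X i * (P + X i * Q) - V ^ 2) = C c * X i * (P' + X i * Q') - V' ^ 2 := by
    change bind₁ (fun j => X j + C (a j)) _ = _
    rw [map_sub, map_mul, map_mul, map_add, map_mul, map_pow, bind₁_C_right, hχτ]
  rw [hχeq] at hmem
  have hP'free : i ∉ P'.vars := not_mem_vars_translate hP a
  -- the `τ¹`-slice: every monomial of `P'` has degree `≥ d`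
  apply NonRationalWindow.BiConeForms.isHomogeneous_of_mem_pow_idealOfVars
  · rw [mem_pow_idealOfVars_iff]
    intro m hm
    by_contra hlt
    replace hlt := not_le.mp hlt
    have hmi : m i = 0 := by
      by_contra hne
      exact hP'free ((mem_vars_iff_mem_support i).mpr ⟨m, hm, Finsupp.mem_support_iff.mpr hne⟩)
    -- the coefficient of `m + e_i` in the congruence
    set m' := m + Finsupp.single i 1 with hm'
    have hdeg' : m'.degree = m.degree + 1 := by rw [hm', map_add, Finsupp.degree_single]
    have hzero : coeff m' (C c * X i * (P' + X i * Q') - V' ^ 2) = 0 :=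
      (mem_pow_idealOfVars_iff' (d + 1) _).mp hmem m' (by omega)
    have hsq : coeff m' (V' ^ 2) = 0 := coeff_sq_eq_zero_of_odd V' (i := i) (by rw [hm']; simp [hmi])
    have hXQ : coeff m (X i * Q') = 0 := by
      rw [coeff_X_mul', if_neg (by rw [Finsupp.mem_support_iff, hmi]; exact fun h => h rfl)]
    have hi' : i ∈ m'.support := by rw [hm', Finsupp.mem_support_iff]; simp
    have hsub : m' - Finsupp.single i 1 = m := by rw [hm', add_tsub_cancel_right]
    rw [coeff_sub, hsq, sub_zero, mul_assoc, coeff_C_mul, coeff_X_mul', if_pos hi', hsub, coeff_add, hXQ, add_zero,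
      mul_eq_zero] at hzero
    rcases hzero with h0 | h0
    · exact hc h0
    · exact (mem_support_iff.mp hm) h0
  · exact (NonRationalWindow.BiConeForms.totalDegree_bind₁_translate_le _ _).trans hdeg

end Reading

end SatParity

end Summit.ResolutionOfSingularities.ResolutionOfSingularities.Theorems.SwitchingDichotomy.ArithTransport

end
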